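import Literature.InformationTheory.QuantumCodes.QuantumHammingBoundDistanceFiveFrom26
import Literature.InformationTheory.QuantumCodes.QuantumHammingBoundDistanceThree
import Literature.InformationTheory.QuantumCodes.QuantumSingletonBound
import Summits.Ventures.QEC.Census.LPBounds.NoCodeK00
import Summits.Ventures.QEC.Census.LPBounds.NoCodeK01To03
import Summits.Ventures.QEC.Census.LPBounds.NoCodeK04To06
import Summits.Ventures.QEC.Census.LPBounds.NoCodeK07To09
import Summits.Ventures.QEC.Census.LPBounds.NoCodeK10To13
import Summits.Ventures.QEC.Census.LPBounds.NoCodeK14To18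
import HarnessLib

/-!
# The quantum Hamming bound for every binary stabilizer code of distance 3 and of distance 5, at every length

Venture QEC (cell `qec`), item 117 «QHB-ALLN» (lead block 93 (4)), rung X1; Summit-side assembly file (no new
mathematics: it JOINS results already in the tree). Pre-registered statements (block 93 (4), verbatim):

* `quantumHammingBound_five_allN  : ∀ n k, AdditiveCodeExists n k 5 → (1 + 3n + 9·C(n,2))·2^k ≤ 2^n`,
* `quantumHammingBound_three_allN : ∀ n k, AdditiveCodeExists n k 3 → (1 + 3n)·2^k ≤ 2^n`.

(`AdditiveCodeExists n k d` = «an `[[n,k,d]]` additive (binary stabilizer) code exists», CRSS §2 Thm. 1, file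
`Literature/…/SymplecticCodes.lean`; degenerate codes included; `C(n,2) = n.choose 2`.)

How (the words of record on ACCEPT, block 93 (4)): «small lengths by kernel nonexistence certificates, large lengths
by counting». Precisely:

* LARGE `n` — counting, LP-free: `AdditiveCodeExists.quantumHammingBound_five` (`n ≥ 26`, qec-lit-4, file
  `QuantumHammingBoundDistanceFiveFrom26.lean`: Gottesman's generator-counting method completed with a private-qubit
  constraint and CRSS Thm. 6 (e) shortening) and `AdditiveCodeExists.hammingBound_three` (`n ≥ 9`, qec-lit-1, file
  `QuantumHammingBoundDistanceThree.lean`). [cite: Gottesman1997, Ch. 7 §7.3 (arXiv:quant-ph/9705052 chunks p0059 L1–p0060 L30)]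
* SMALL `n` — the census's KERNEL nonexistence cells `Summit.Ventures.QEC.Census.NoCode.noCode_n_k :
  ¬ AdditiveCodeExists n k (d_LP + 1)` (files `Census/LPBounds/NoCodeK*.lean`, qec-type-06: exact-rational LP
  infeasibility certificates checked by `decide +kernel`, CRSS Thm. 21 + Thm. 6 (e), all PROVED in the tree), used
  at the BOUNDARY cell `(n, k₀(n)+1)` of each length, `k₀(n) = max {k : Q(n)·2^k ≤ 2^n}`:
  `d = 5`, `Q(n) = 1 + 3n + 9·C(n,2)`: `(9,1)` [cell states `d ≤ 3`, used through monotonicity in `d`], `(10,2)`,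
  `(11,2)`, `(12,3)`, `(13,4)`, `(14,5)`, `(15,6)`, `(16,6)`, `(17,7)`, `(18,8)`, `(19,9)`, `(20,10)`, `(21,11)`,
  `(22,11)`, `(23,12)`, `(24,13)`, `(25,14)`; `d = 3`, `Q(n) = 1 + 3n`: `(4,1)`, `(5,2)`, `(6,2)`, `(7,3)`, `(8,4)`.
  A code with `k > k₀(n)` descends to the boundary cell by CRSS Thm. 6 (c) (`CRSS1998_theorem6c`: `[[n,k+1,d]] ⇒
  [[n,k,d]]` for `k ≥ 1`; every boundary cell has `k₀(n)+1 ≥ 1`), so `k ≤ k₀(n)` and `Q(n)·2^k ≤ Q(n)·2^{k₀(n)} ≤ 2^n`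
  by arithmetic. [cite: CalderbankEtAl1998, §4 Thm. 6 (c) (printed p. 13) and §8 Table III (printed pp. 32–34)]
* LENGTHS WITH NO CODE AT ALL (`d = 5`: `1 ≤ n ≤ 8`; `d = 3`: `1 ≤ n ≤ 3`, where `Q(n) > 2^n`): `k ≥ 1` contradicts
  the quantum Singleton bound `k + 2d ≤ n + 2` (`AdditiveCodeExists.quantumSingleton`, PROVED in the tree), and
  `k = 0` is excluded by the cells `noCode_3_0`, `noCode_4_0` (`d ≤ 2`), `noCode_5_0` (`d ≤ 3`), `noCode_6_0`,
  `noCode_7_0`, `noCode_8_0` (`d ≤ 4`) or, for `n ≤ 2`, by the `k = 0` convention of `IsAdditiveCode` itself (a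
  nonzero word of `S̄`, `dim S̄ = n ≥ 1`, has weight `≤ n < d`). `n = 0`: `k = 0` and `Q(0)·1 = 1 ≤ 1`.

Coverage: EVERY `n` and `k` (exhaustive case split `n ≤ 25` / `n ≤ 8` by `interval_cases`, each case closed by a
named kernel theorem; no cell is weakened or skipped — GAP RULE of block 93 (4): none arose, cf. qec-lit-4's CELL
INVENTORY, INBOX 2026-08-27T09:47:46Z). Tier KERNEL: no `native_decide`, no named-fact hypothesis, axioms standard
(the imported `NoCodeK*` cells are `decide +kernel` certificate checks).

HONEST FRAMING / prior art (qec-lit-4 register `lit/LIT-4-REGISTER.md` §B2, presearch 2026-08-27T09:43–09:47Z): the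
statement is IN PRINT — asserted for binary stabilizer codes by Gottesman (1997, §7.3; the printed counting argument
is incomplete for `31 ≤ n ≤ 52` and defers `n ≤ 30` to LP tables) and covered by LP-polynomial arguments (Aly 2007,
arXiv:0711.4603 Lemma 4; Li–Xing 2010, IEEE TIT 56:4731, with numerically located thresholds; Dallas–Andreadakis–Lidar
2022, arXiv:2208.11800 §3.2). What is new here is only that the whole statement is MACHINE-CHECKED (small lengths by
kernel LP-infeasibility certificates, large lengths by an LP-free counting proof). No priority claim; column: proved.

Contents: `dist_le_of_zero` (`[[n,0,d]]`, `n ≥ 1` ⇒ `d ≤ n`), `descend` (`[[n,K,d]]`, `1 ≤ T ≤ K` ⇒ `[[n,T,d]]`),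
`bound_of_cell` (the boundary-cell step), `false_of_noCode_zero` (no code at all), the two headline theorems, and
their contrapositives `not_additiveCodeExists_five_of_hamming` / `not_additiveCodeExists_three_of_hamming_allN`.
-/

namespace Summit.Ventures.QEC.Census.QuantumHammingBoundAllN

open Literature.InformationTheory.QuantumCodes Summit.Ventures.QEC.Census.NoCode

/-- An `[[n,0,d]]` additive code of length `n ≥ 1` has `d ≤ n`: by the `k = 0` convention of `IsAdditiveCode`
(«an `[[n,0,d]]` code is pure by convention»: `d` bounds the minimal nonzero weight of the self-dual `S̄`), and
`S̄` of dimension `n ≥ 1` has a nonzero word, of weight `≤ n`. (proved)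
[cite: CalderbankEtAl1998, §3 (printed p. 10, convention for k = 0) and §2 (printed p. 4, weight)] -/
theorem dist_le_of_zero {n d : ℕ} (h : AdditiveCodeExists n 0 d) (hn : 1 ≤ n) : d ≤ n := by
  obtain ⟨S, -, hdim, -, hzero⟩ := h
  have hS : S ≠ ⊥ := by
    rintro rfl
    simp at hdim
    omega
  obtain ⟨v, hv, hv0⟩ := (Submodule.ne_bot_iff S).1 hS
  exact (hzero rfl v hv hv0).trans (sympWeight_le v)

/-- Descent in `k` (iterated CRSS Thm. 6 (c)): if an `[[n,K,d]]` additive code exists and `1 ≤ T ≤ K` then an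
`[[n,T,d]]` additive code exists («there are additive codes `B`, `B⊥` with `C ⊂ B ⊂ B⊥ ⊂ C⊥`»; each step needs the
target dimension to stay positive). (proved) [cite: CalderbankEtAl1998, §4 Thm. 6 (c) (printed p. 13)] -/
theorem descend {n d T : ℕ} (hT : 1 ≤ T) :
    ∀ {K : ℕ}, T ≤ K → AdditiveCodeExists n K d → AdditiveCodeExists n T d
  | 0, hTK, _ => absurd hTK (by omega)
  | K + 1, hTK, h => by
    rcases Nat.eq_or_lt_of_le hTK with rfl | hlt
    · exact h
    · exact descend hT (Nat.le_of_lt_succ hlt) (CRSS1998_theorem6c n K d h (Or.inl (by omega)))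

/-- The boundary-cell step: if an `[[n,k,d]]` additive code exists, NO `[[n,K+1,d]]` additive code exists, and
`Q·2^K ≤ 2^n`, then `Q·2^k ≤ 2^n` — for `k ≥ K+1` the code would descend to an `[[n,K+1,d]]` code (CRSS Thm. 6 (c)),
so `k ≤ K`. (proved) [cite: CalderbankEtAl1998, §4 Thm. 6 (c) (printed p. 13) and §8 Table III (printed pp. 32–34)] -/
theorem bound_of_cell {n k d Q K : ℕ} (h : AdditiveCodeExists n k d) (hK : ¬ AdditiveCodeExists n (K + 1) d)
    (hQ : Q * 2 ^ K ≤ 2 ^ n) : Q * 2 ^ k ≤ 2 ^ n := by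
  have hk : k ≤ K := by
    by_contra hlt
    exact hK (descend (by omega) (by omega) h)
  exact (Nat.mul_le_mul_left Q (Nat.pow_le_pow_right (by norm_num) hk)).trans hQ

/-- Lengths with no code at all: if no `[[n,0,d]]` additive code exists and `n + 2 < 1 + 2d` (so that the quantum
Singleton bound `k + 2d ≤ n + 2` excludes every `k ≥ 1`), then no `[[n,k,d]]` additive code exists for any `k`.
(proved) [cite: Rains1999Nonbinary, Thm. 2 with Thm. 1 (quantum Singleton bound, binary additive case); CalderbankEtAl1998, §7 eq. (15) (printed p. 26)] -/
theorem false_of_noCode_zero {n k d : ℕ} (h : AdditiveCodeExists n k d) (h0 : ¬ AdditiveCodeExists n 0 d)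
    (hn : n + 2 < 1 + 2 * d) : False := by
  rcases Nat.eq_zero_or_pos k with rfl | hk
  · exact h0 h
  · have := h.quantumSingleton hk
    omega

/-- **The quantum Hamming bound for every `[[n,k,5]]` binary stabilizer code, at every length** (pre-registered
statement of item 117, verbatim): if an `[[n,k,5]]` additive code exists then `(1 + 3n + 9·C(n,2))·2^k ≤ 2^n`,
degenerate codes included. Large lengths (`n ≥ 26`) by qec-lit-4's LP-free counting theorem
`AdditiveCodeExists.quantumHammingBound_five`; `9 ≤ n ≤ 25` by the census's kernel LP-infeasibility cells at the
boundary `(n, k₀(n)+1)` and descent in `k`; `1 ≤ n ≤ 8` carry no distance-5 code at all (quantum Singleton for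
`k ≥ 1`, the `k = 0` cells / convention otherwise); `n = 0` is `1 ≤ 1`. Printed claim: Gottesman asserts the bound
for all binary stabilizer codes with `t = 2` (analytically for large `n`, LP tables below); in print also via LP
arguments — so no priority claim; what is certified here is a machine-checked proof at every length. (proved, KERNEL)
[cite: Gottesman1997, Ch. 7 §7.3 (arXiv:quant-ph/9705052 chunks p0059 L1–p0060 L30); CalderbankEtAl1998, §8 Table III (printed pp. 32–34) and §4 Thm. 6 (c) (printed p. 13)] -/
theorem quantumHammingBound_five_allN :
    ∀ n k : ℕ, AdditiveCodeExists n k 5 → (1 + 3 * n + 9 * n.choose 2) * 2 ^ k ≤ 2 ^ n := by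
  intro n k h
  rcases Nat.lt_or_ge n 26 with hn | hn
  swap
  · exact h.quantumHammingBound_five hn
  interval_cases n
  · -- `n = 0`: `k = 0`
    obtain rfl : k = 0 := Nat.le_zero.1 h.le
    norm_num
  · -- `n = 1`: no code (`k = 0`: weight convention; `k ≥ 1`: Singleton)
    exact (false_of_noCode_zero h (fun h' => absurd (dist_le_of_zero h' le_rfl) (by norm_num)) (by norm_num)).elim
  · -- `n = 2`
    exact (false_of_noCode_zero h (fun h' => absurd (dist_le_of_zero h' (by norm_num)) (by norm_num))
      (by norm_num)).elim
  · -- `n = 3`: cell `(3,0)`: `d ≤ 2`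
    exact (false_of_noCode_zero h (fun ⟨S, hS⟩ => noCode_3_0 ⟨S, hS.mono (by norm_num)⟩) (by norm_num)).elim
  · -- `n = 4`: cell `(4,0)`: `d ≤ 2`
    exact (false_of_noCode_zero h (fun ⟨S, hS⟩ => noCode_4_0 ⟨S, hS.mono (by norm_num)⟩) (by norm_num)).elim
  · -- `n = 5`: cell `(5,0)`: `d ≤ 3`
    exact (false_of_noCode_zero h (fun ⟨S, hS⟩ => noCode_5_0 ⟨S, hS.mono (by norm_num)⟩) (by norm_num)).elim
  · -- `n = 6`: cell `(6,0)`: `d ≤ 4`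
    exact (false_of_noCode_zero h noCode_6_0 (by norm_num)).elim
  · -- `n = 7`: cell `(7,0)`: `d ≤ 4`
    exact (false_of_noCode_zero h noCode_7_0 (by norm_num)).elim
  · -- `n = 8`: cell `(8,0)`: `d ≤ 4`
    exact (false_of_noCode_zero h noCode_8_0 (by norm_num)).elim
  · -- `n = 9`: `k₀ = 0`, cell `(9,1)`: `d ≤ 3`
    exact bound_of_cell (K := 0) h (fun ⟨S, hS⟩ => noCode_9_1 ⟨S, hS.mono (by norm_num)⟩)
      (by norm_num [Nat.choose_two_right])
  · -- `n = 10`: `k₀ = 1`, cell `(10,2)`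
    exact bound_of_cell (K := 1) h noCode_10_2 (by norm_num [Nat.choose_two_right])
  · -- `n = 11`: `k₀ = 1`, cell `(11,2)`
    exact bound_of_cell (K := 1) h noCode_11_2 (by norm_num [Nat.choose_two_right])
  · -- `n = 12`: `k₀ = 2`, cell `(12,3)`
    exact bound_of_cell (K := 2) h noCode_12_3 (by norm_num [Nat.choose_two_right])
  · -- `n = 13`: `k₀ = 3`, cell `(13,4)`
    exact bound_of_cell (K := 3) h noCode_13_4 (by norm_num [Nat.choose_two_right])
  · -- `n = 14`: `k₀ = 4`, cell `(14,5)`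
    exact bound_of_cell (K := 4) h noCode_14_5 (by norm_num [Nat.choose_two_right])
  · -- `n = 15`: `k₀ = 5`, cell `(15,6)`
    exact bound_of_cell (K := 5) h noCode_15_6 (by norm_num [Nat.choose_two_right])
  · -- `n = 16`: `k₀ = 5`, cell `(16,6)`
    exact bound_of_cell (K := 5) h noCode_16_6 (by norm_num [Nat.choose_two_right])
  · -- `n = 17`: `k₀ = 6`, cell `(17,7)`
    exact bound_of_cell (K := 6) h noCode_17_7 (by norm_num [Nat.choose_two_right])
  · -- `n = 18`: `k₀ = 7`, cell `(18,8)`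
    exact bound_of_cell (K := 7) h noCode_18_8 (by norm_num [Nat.choose_two_right])
  · -- `n = 19`: `k₀ = 8`, cell `(19,9)`
    exact bound_of_cell (K := 8) h noCode_19_9 (by norm_num [Nat.choose_two_right])
  · -- `n = 20`: `k₀ = 9`, cell `(20,10)`
    exact bound_of_cell (K := 9) h noCode_20_10 (by norm_num [Nat.choose_two_right])
  · -- `n = 21`: `k₀ = 10`, cell `(21,11)`
    exact bound_of_cell (K := 10) h noCode_21_11 (by norm_num [Nat.choose_two_right])
  · -- `n = 22`: `k₀ = 10`, cell `(22,11)`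
    exact bound_of_cell (K := 10) h noCode_22_11 (by norm_num [Nat.choose_two_right])
  · -- `n = 23`: `k₀ = 11`, cell `(23,12)`
    exact bound_of_cell (K := 11) h noCode_23_12 (by norm_num [Nat.choose_two_right])
  · -- `n = 24`: `k₀ = 12`, cell `(24,13)`
    exact bound_of_cell (K := 12) h noCode_24_13 (by norm_num [Nat.choose_two_right])
  · -- `n = 25`: `k₀ = 13`, cell `(25,14)`
    exact bound_of_cell (K := 13) h noCode_25_14 (by norm_num [Nat.choose_two_right])

/-- Contrapositive, the form used to fill code tables, at every length: **no `[[n,k,5]]` binary stabilizer code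
with `(1 + 3n + 9·C(n,2))·2^k > 2^n`.** (proved, KERNEL)
[cite: Gottesman1997, Ch. 7 §7.3 (arXiv:quant-ph/9705052 chunk p0060 L28–30); CalderbankEtAl1998, §8 Table III (printed pp. 32–34)] -/
theorem not_additiveCodeExists_five_of_hamming {n k : ℕ} (hk : 2 ^ n < (1 + 3 * n + 9 * n.choose 2) * 2 ^ k) :
    ¬ AdditiveCodeExists n k 5 :=
  fun h => absurd (quantumHammingBound_five_allN n k h) (not_le.2 hk)

/-- **The quantum Hamming bound for every `[[n,k,3]]` binary stabilizer code, at every length** (pre-registered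
statement of item 117, verbatim): if an `[[n,k,3]]` additive code exists then `(1 + 3n)·2^k ≤ 2^n`, degenerate
codes included. `n ≥ 9` by qec-lit-1's `AdditiveCodeExists.hammingBound_three` (Gottesman's counting argument,
LP-free); `4 ≤ n ≤ 8` by the census's kernel LP-infeasibility cells `(4,1)`, `(5,2)`, `(6,2)`, `(7,3)`, `(8,4)` and
descent in `k`; `1 ≤ n ≤ 3` carry no distance-3 code (quantum Singleton for `k ≥ 1`; cell `(3,0)` / the `k = 0`
convention); `n = 0` is `1 ≤ 1`. Printed claim: «an impure one-error-correcting binary stabilizer code cannot beat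
the quantum Hamming bound», for all `n` in print via the LP tables at small `n` — no priority claim; certified here
as a machine-checked proof at every length. (proved, KERNEL)
[cite: Gottesman1997, Ch. 7 §7.3 (arXiv:quant-ph/9705052 chunk p0059 L57–60); CalderbankEtAl1998, §8 Table III (printed pp. 32–34) and §4 Thm. 6 (c) (printed p. 13)] -/
theorem quantumHammingBound_three_allN :
    ∀ n k : ℕ, AdditiveCodeExists n k 3 → (1 + 3 * n) * 2 ^ k ≤ 2 ^ n := by
  intro n k h
  rcases Nat.lt_or_ge n 9 with hn | hn
  swap
  · rw [Nat.add_comm]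
    exact h.hammingBound_three hn
  interval_cases n
  · -- `n = 0`: `k = 0`
    obtain rfl : k = 0 := Nat.le_zero.1 h.le
    norm_num
  · -- `n = 1`: no code
    exact (false_of_noCode_zero h (fun h' => absurd (dist_le_of_zero h' le_rfl) (by norm_num)) (by norm_num)).elim
  · -- `n = 2`: no code
    exact (false_of_noCode_zero h (fun h' => absurd (dist_le_of_zero h' (by norm_num)) (by norm_num))
      (by norm_num)).elim
  · -- `n = 3`: cell `(3,0)`: `d ≤ 2`
    exact (false_of_noCode_zero h noCode_3_0 (by norm_num)).elim
  · -- `n = 4`: `k₀ = 0`, cell `(4,1)`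
    exact bound_of_cell (K := 0) h noCode_4_1 (by norm_num)
  · -- `n = 5`: `k₀ = 1`, cell `(5,2)`
    exact bound_of_cell (K := 1) h noCode_5_2 (by norm_num)
  · -- `n = 6`: `k₀ = 1`, cell `(6,2)`
    exact bound_of_cell (K := 1) h noCode_6_2 (by norm_num)
  · -- `n = 7`: `k₀ = 2`, cell `(7,3)`
    exact bound_of_cell (K := 2) h noCode_7_3 (by norm_num)
  · -- `n = 8`: `k₀ = 3`, cell `(8,4)`
    exact bound_of_cell (K := 3) h noCode_8_4 (by norm_num)

/-- Contrapositive at every length: **no `[[n,k,3]]` binary stabilizer code with `(1 + 3n)·2^k > 2^n`** (the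
tree's `not_additiveCodeExists_three_of_hamming` is the `n ≥ 9` case). (proved, KERNEL)
[cite: Gottesman1997, Ch. 7 §7.3 (arXiv:quant-ph/9705052 chunk p0059 L57–60); CalderbankEtAl1998, §8 Table III (printed pp. 32–34)] -/
theorem not_additiveCodeExists_three_of_hamming_allN {n k : ℕ} (hk : 2 ^ n < (1 + 3 * n) * 2 ^ k) :
    ¬ AdditiveCodeExists n k 3 :=
  fun h => absurd (quantumHammingBound_three_allN n k h) (not_le.2 hk)

/-! ## Monotone and `Σ`-shaped corollaries (appended 2026-08-27, qec-type-08 gen 5) -/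

/-- **Every binary stabilizer code of distance `d ≥ 5` obeys the `t = 2` quantum Hamming bound, at every length**:
`(1 + 3n + 9·C(n,2))·2^k ≤ 2^n` (an `[[n,k,d]]` code is an `[[n,k,5]]` code, `IsAdditiveCode.mono`). (proved, KERNEL)
[cite: Gottesman1997, Ch. 7 §7.3 (arXiv:quant-ph/9705052 chunks p0059 L1–p0060 L30); CalderbankEtAl1998, §2 Thm. 1 (printed p. 4: monotonicity of the distance condition)] -/
theorem quantumHammingBound_two_of_five_le {n k d : ℕ} (hd : 5 ≤ d) (h : AdditiveCodeExists n k d) :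
    (1 + 3 * n + 9 * n.choose 2) * 2 ^ k ≤ 2 ^ n := by
  obtain ⟨S, hS⟩ := h
  exact quantumHammingBound_five_allN n k ⟨S, hS.mono hd⟩

/-- **Every binary stabilizer code of distance `d ≥ 3` obeys the `t = 1` quantum Hamming bound, at every length**:
`(1 + 3n)·2^k ≤ 2^n`. (proved, KERNEL)
[cite: Gottesman1997, Ch. 7 §7.3 (arXiv:quant-ph/9705052 chunk p0059 L57–60); CalderbankEtAl1998, §2 Thm. 1 (printed p. 4)] -/
theorem quantumHammingBound_one_of_three_le {n k d : ℕ} (hd : 3 ≤ d) (h : AdditiveCodeExists n k d) :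
    (1 + 3 * n) * 2 ^ k ≤ 2 ^ n := by
  obtain ⟨S, hS⟩ := h
  exact quantumHammingBound_three_allN n k ⟨S, hS.mono hd⟩

/-- The `Σ_{j ≤ 2} 3^j C(n,j)` shape (as in the tree's `quantumHammingBound`, `t = 2`), every `[[n,k,5]]` additive code, EVERY
`n` (the tree's `AdditiveCodeExists.quantumHammingBound_five_range` is the `n ≥ 26` case). (proved, KERNEL)
[cite: Gottesman1997, Ch. 7 §7.1 eq. (7.1) and §7.3 (arXiv:quant-ph/9705052 chunks p0055 L27-30, p0060 L28-30)] -/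
theorem quantumHammingBound_five_allN_range (n k : ℕ) (h : AdditiveCodeExists n k 5) :
    (∑ j ∈ Finset.range (2 + 1), 3 ^ j * n.choose j) * 2 ^ k ≤ 2 ^ n := by
  have h' := quantumHammingBound_five_allN n k h
  simpa [Finset.sum_range_succ, add_assoc] using h'

/-- The `Σ_{j ≤ 1} 3^j C(n,j)` shape (`t = 1`), every `[[n,k,3]]` additive code, EVERY `n` (the tree's
`AdditiveCodeExists.hammingBound_three_range` is the `n ≥ 9` case). (proved, KERNEL)
[cite: Gottesman1997, Ch. 7 §7.1 eq. (7.1) and §7.3 (arXiv:quant-ph/9705052 chunks p0055 L27-30, p0059 L57-60)] -/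
theorem quantumHammingBound_three_allN_range (n k : ℕ) (h : AdditiveCodeExists n k 3) :
    (∑ j ∈ Finset.range (1 + 1), 3 ^ j * n.choose j) * 2 ^ k ≤ 2 ^ n := by
  have h' := quantumHammingBound_three_allN n k h
  simpa [Finset.sum_range_succ] using h'

end Summit.Ventures.QEC.Census.QuantumHammingBoundAllN
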